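import Mathlib.Analysis.Fourier.FourierTransform
import Mathlib.Analysis.Calculus.MeanValue
import Mathlib.Analysis.Calculus.ContDiff.Basic
import Mathlib.Analysis.SpecialFunctions.Log.Deriv
import Mathlib.Analysis.SpecialFunctions.ExpDeriv
import Mathlib.MeasureTheory.Function.LpSeminorm.CompareExp
import Mathlib.MeasureTheory.Function.LpSpace.Basic
import Mathlib.MeasureTheory.Group.Integral
import HarnessLib

/-!
# Bourgain–Dyatlov 2018, Theorem 5, from the Beurling–Malliavin multiplier theorem (Theorem BM1)

Topic `Literature/Analysis/Fourier`. The "first Beurling–Malliavin theorem" (A. Beurling,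
P. Malliavin, *On Fourier transforms of measures with compact support*, Acta Math. 107 (1962);
J. Mashreghi, F. Nazarov, V. Havin, *Beurling–Malliavin multiplier theorem: the seventh proof*,
St. Petersburg Math. J. 17 (2006) 699–744, Theorem BM1, p. 700, which gives a complete proof):
if `ω : ℝ → (0, 1]` is continuous, `∫ log ω(x)/(1+x²) dx > -∞` and `log ω` is Lipschitz, then
for every `σ > 0` there is a nonzero `f ∈ L²(ℝ)` whose spectrum lies in a segment of length `σ`
and `|f(x)| ≤ ω(x)` for all `x`. It is a deep theorem (46 pages in [MNH06]; Hardy classes, outer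
functions and the Hilbert transform, none of which Mathlib has); in this file it enters as the
explicit HYPOTHESIS `hBM1` of the theorems below (no named fact is introduced), quoted from
[MNH06, Theorem BM1, p. 700]: "Let `ω` be a continuous function defined on `ℝ` and satisfying
`0 < ω ≤ 1`, `∫_ℝ log ω(x)/(1+x²) dx > -∞`. If `log ω` satisfies the Lipschitz condition, i.e.,
`|log ω(x') - log ω(x'')| ≤ K|x' - x''|` for some `K > 0` and all `x', x'' ∈ ℝ`, then for every
`σ > 0` there is a nonzero function `f ∈ L²(ℝ)` such that `spec f` is included in a segment of
length `σ` and `|f(x)| ≤ ω(x)` for all `x ∈ ℝ`", with the spectrum condition written out: an `L²`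
function with spectrum in a segment of length `σ` is `𝓕 φ` for a `φ ∈ L²` vanishing off a
segment `[a, a+σ]` (then `φ ∈ L¹`, `𝓕 φ` is the continuous representative, and "`f` nonzero" is
"`φ` not a.e. zero" by Plancherel), so no `L²`-Fourier transform is needed, and the finiteness
of the logarithmic integral (`log ω ≤ 0`) as integrability of `log ω(x)/(1+x²)`.

It is the one external input of J. Bourgain, S. Dyatlov, *Spectral gaps without the pressure
condition*, Ann. of Math. 187 (2018) (there: Theorem 5, attributed to [MNH06]), towards the
named fact `bourgainDyatlov2018_thm4` (`FractalUncertaintyPrinciple.lean`). PROVED here: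

* `fourier_comp_add_right_apply`, `norm_fourier_comp_add_right` — translating `φ` multiplies
  `𝓕 φ` by a unimodular phase;
* `bourgainDyatlov2018_thm5_of_BM1` — **BD18 Theorem 5 from Theorem BM1**, in exactly the form
  taken as the hypothesis `hBM` by `bd18_lemma_2_11_of_multiplierTheorem` (`QuantitativeBeurlingMalliavin.lean`)
  and `bd18_lemma_3_1_of_multiplierTheorem` (`AdaptedMultiplierOfBM.lean`): for
  `ω ∈ C¹(ℝ; (0,1])` with `∫ |log ω|/(1+ξ²) < ∞`, `sup |∂ log ω| < ∞` and every `c₀ > 0` there is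
  `ψ ∈ L²`, `supp ψ ⊆ [-c₀, c₀]`, `|𝓕 ψ| ≤ ω`, `ψ ≢ 0` (from BM1 with `σ = 2c₀`: a bounded
  derivative of `log ω` makes it Lipschitz by the mean value theorem, and a translate of `φ`
  recentres the support without changing `|𝓕 φ|`);
* `beurlingMalliavin_exponent_of_BM1` — the same for weights `ω = e^{-Ω}`, `Ω ≥ 0` of class `C¹`
  with `|Ω'| ≤ K`, `∫ Ω/(1+ξ²) < ∞` (the hypothesis `hBM` of `quantitativeBM_of_beurlingMalliavin`,
  `FractalUncertaintyQuantitativeBM.lean`).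

## References

* [BeurlingMalliavin1962] A. Beurling, P. Malliavin, *On Fourier transforms of measures with
  compact support*, Acta Math. 107 (1962), 291–309.
* [MashreghiNazarovHavin2006] J. Mashreghi, F. L. Nazarov, V. P. Havin, *Beurling–Malliavin
  multiplier theorem: the seventh proof*, St. Petersburg Math. J. 17 (2006), no. 5, 699–744,
  Theorem BM1 (p. 700).
* [BourgainDyatlov2018] J. Bourgain, S. Dyatlov, *Spectral gaps without the pressure condition*,
  Ann. of Math. (2) 187 (2018), 825–867, §2.3, Theorem 5.
-/

namespace Literature.Analysis.Fourier

open _root_.MeasureTheory Set Filter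
open scoped FourierTransform Real

/-- Translating a function multiplies its Fourier transform by a unimodular phase:
`𝓕 (φ(· + b))(w) = 𝐞(b w) 𝓕 φ (w)`. [folklore] -/
theorem fourier_comp_add_right_apply (φ : ℝ → ℂ) (b w : ℝ) :
    𝓕 (fun x => φ (x + b)) w = ((𝐞 (b * w) : Circle) : ℂ) * 𝓕 φ w := by
  rw [Real.fourier_real_eq, Real.fourier_real_eq]
  simp_rw [Circle.smul_def, smul_eq_mul]
  rw [← integral_sub_right_eq_self (fun v => ((𝐞 (-(v * w)) : Circle) : ℂ) * φ (v + b)) b,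
    ← integral_const_mul]
  congr 1
  funext v
  rw [sub_add_cancel, show -((v - b) * w) = b * w + -(v * w) by ring, AddChar.map_add_eq_mul,
    Circle.coe_mul]
  ring

/-- `|𝓕 (φ(· + b))| = |𝓕 φ|`. [folklore] -/
theorem norm_fourier_comp_add_right (φ : ℝ → ℂ) (b w : ℝ) :
    ‖𝓕 (fun x => φ (x + b)) w‖ = ‖𝓕 φ w‖ := by
  rw [fourier_comp_add_right_apply, norm_mul, Circle.norm_coe, one_mul]

/-- A translate of a function that is not a.e. zero is not a.e. zero. [folklore] -/
theorem not_ae_eq_zero_comp_add_right {φ : ℝ → ℂ} (hφ : ¬ (φ =ᵐ[volume] 0)) (b : ℝ) :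
    ¬ ((fun x => φ (x + b)) =ᵐ[volume] 0) := by
  intro h
  apply hφ
  have hq : Measure.QuasiMeasurePreserving (fun y : ℝ => y - b) volume volume :=
    (measurePreserving_sub_right volume b).quasiMeasurePreserving
  have h2 := hq.ae_eq h
  simp only [Function.comp_def, sub_add_cancel] at h2
  exact h2

/-- **Bourgain–Dyatlov 2018, Theorem 5, from Theorem BM1.** "Let `ω ∈ C¹(ℝ; (0,1])` satisfy
`∫ |log ω(ξ)|/(1+ξ²) dξ < ∞` and `sup |∂_ξ log ω| < ∞`. Then for each `c₀ > 0` there exists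
`ψ ∈ L²(ℝ)` such that `supp ψ ⊂ [-c₀, c₀]`, `|ψ̂| ≤ ω`, `ψ ≢ 0`." Deduced from
Theorem BM1 (`hBM1`) with `σ = 2c₀`: `log ω` is Lipschitz by the mean value theorem, and the
translate `ψ = φ(· + a + c₀)` of the `φ` given by BM1 has support in `[-c₀, c₀]` and
`|𝓕 ψ| = |𝓕 φ| ≤ ω`. The hypothesis `hBM1` is Theorem BM1 of [MNH06] (see the module
docstring); the conclusion is stated in exactly the form of the hypothesis `hBM` of
`bd18_lemma_2_11_of_multiplierTheorem` and `bd18_lemma_3_1_of_multiplierTheorem`.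
[cite: BourgainDyatlov2018, Theorem 5] [cite: MashreghiNazarovHavin2006, Theorem BM1 (p. 700)] -/
theorem bourgainDyatlov2018_thm5_of_BM1
    (hBM1 : ∀ ω : ℝ → ℝ, Continuous ω → (∀ x, 0 < ω x) → (∀ x, ω x ≤ 1) →
      Integrable (fun x => Real.log (ω x) / (1 + x ^ 2)) →
      (∃ K : ℝ, ∀ x y, |Real.log (ω x) - Real.log (ω y)| ≤ K * |x - y|) →
      ∀ σ : ℝ, 0 < σ → ∃ (a : ℝ) (φ : ℝ → ℂ), MemLp φ 2 volume ∧ ¬ (φ =ᵐ[volume] 0) ∧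
        (∀ ξ, ξ ∉ Icc a (a + σ) → φ ξ = 0) ∧ ∀ x, ‖𝓕 φ x‖ ≤ ω x) :
    ∀ ω : ℝ → ℝ, ContDiff ℝ 1 ω → (∀ ξ, 0 < ω ξ) → (∀ ξ, ω ξ ≤ 1) →
      Integrable (fun ξ => |Real.log (ω ξ)| / (1 + ξ ^ 2)) →
      (∃ C : ℝ, ∀ ξ, |deriv (fun η => Real.log (ω η)) ξ| ≤ C) →
      ∀ c₀ : ℝ, 0 < c₀ → ∃ ψ : ℝ → ℂ, MemLp ψ 2 volume ∧ (∀ x, x ∉ Icc (-c₀) c₀ → ψ x = 0) ∧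
        (∀ ξ, ‖𝓕 ψ ξ‖ ≤ ω ξ) ∧ ¬ (ψ =ᵐ[volume] 0) := by
  intro ω hω hpos hle hint hderiv c₀ hc₀
  obtain ⟨C, hC⟩ := hderiv
  have hωc : Continuous ω := hω.continuous
  have hlogc : Continuous fun x => Real.log (ω x) := hωc.log fun x => (hpos x).ne'
  -- the logarithmic integral
  have hint' : Integrable (fun x => Real.log (ω x) / (1 + x ^ 2)) := by
    refine hint.mono' ((hlogc.div (by fun_prop) fun x => by positivity).aestronglyMeasurable)
      (Eventually.of_forall fun x => ?_)
    rw [Real.norm_eq_abs, abs_div, abs_of_pos (by positivity : (0 : ℝ) < 1 + x ^ 2)]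
  -- `log ω` is Lipschitz (mean value theorem)
  have hdiff : ∀ x, DifferentiableAt ℝ (fun η => Real.log (ω η)) x := fun x =>
    ((hω.differentiable one_ne_zero) x).log (hpos x).ne'
  have hLip : ∃ K : ℝ, ∀ x y, |Real.log (ω x) - Real.log (ω y)| ≤ K * |x - y| := by
    refine ⟨C, fun x y => ?_⟩
    have h := Convex.norm_image_sub_le_of_norm_deriv_le (f := fun η => Real.log (ω η))
      (s := univ) (fun z _ => hdiff z) (fun z _ => by simpa using hC z) convex_univ
      (mem_univ y) (mem_univ x)
    simpa [Real.norm_eq_abs] using h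
  -- BM1 with `σ = 2c₀`, then recentre
  obtain ⟨a, φ, hφ2, hφne, hφsupp, hφle⟩ :=
    hBM1 ω hωc hpos hle hint' hLip (2 * c₀) (by positivity)
  refine ⟨fun x => φ (x + (a + c₀)), ?_, ?_, ?_, not_ae_eq_zero_comp_add_right hφne _⟩
  · exact hφ2.comp_measurePreserving (measurePreserving_add_right volume (a + c₀))
  · intro x hx
    refine hφsupp _ fun hmem => hx ?_
    simp only [mem_Icc] at hmem ⊢
    constructor <;> linarith [hmem.1, hmem.2]
  · intro ξ
    rw [norm_fourier_comp_add_right]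
    exact hφle ξ

/-- **Theorem BM1 for weights `ω = e^{-Ω}`** (the form of BD18 Theorem 5 used with the adapted
weight exponents of BD18 §3.1): for `Ω ∈ C¹(ℝ)`, `Ω ≥ 0`, `|Ω'| ≤ K`, `∫ Ω/(1+ξ²) < ∞` and every
`c₀ > 0` there is `ψ ∈ L¹ ∩ L²`, `ψ = 0` off `[-c₀, c₀]`, `|𝓕 ψ| ≤ e^{-Ω}`, `ψ ≢ 0` — the
hypothesis `hBM` of `quantitativeBM_of_beurlingMalliavin`.
[cite: BourgainDyatlov2018, Theorem 5] [cite: MashreghiNazarovHavin2006, Theorem BM1 (p. 700)] -/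
theorem beurlingMalliavin_exponent_of_BM1
    (hBM1 : ∀ ω : ℝ → ℝ, Continuous ω → (∀ x, 0 < ω x) → (∀ x, ω x ≤ 1) →
      Integrable (fun x => Real.log (ω x) / (1 + x ^ 2)) →
      (∃ K : ℝ, ∀ x y, |Real.log (ω x) - Real.log (ω y)| ≤ K * |x - y|) →
      ∀ σ : ℝ, 0 < σ → ∃ (a : ℝ) (φ : ℝ → ℂ), MemLp φ 2 volume ∧ ¬ (φ =ᵐ[volume] 0) ∧
        (∀ ξ, ξ ∉ Icc a (a + σ) → φ ξ = 0) ∧ ∀ x, ‖𝓕 φ x‖ ≤ ω x) :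
    ∀ Ω : ℝ → ℝ, ContDiff ℝ 1 Ω → (∀ ξ, 0 ≤ Ω ξ) → (∃ K, ∀ ξ, |deriv Ω ξ| ≤ K) →
      Integrable (fun ξ => Ω ξ / (1 + ξ ^ 2)) → ∀ c₀ : ℝ, 0 < c₀ →
      ∃ ψ : ℝ → ℂ, Integrable ψ ∧ MemLp ψ 2 volume ∧ (∀ x, c₀ < |x| → ψ x = 0) ∧
        (∀ ξ, ‖(𝓕 ψ : ℝ → ℂ) ξ‖ ≤ Real.exp (-Ω ξ)) ∧ ¬ (ψ =ᵐ[volume] 0) := by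
  intro Ω hΩ hΩ0 hK hint c₀ hc₀
  obtain ⟨K, hK⟩ := hK
  have hlog : (fun η => Real.log (Real.exp (-Ω η))) = fun η => -Ω η := by
    funext η; rw [Real.log_exp]
  have hω : ContDiff ℝ 1 fun ξ => Real.exp (-Ω ξ) := Real.contDiff_exp.comp hΩ.neg
  have hpos : ∀ ξ, 0 < Real.exp (-Ω ξ) := fun ξ => Real.exp_pos _
  have hle : ∀ ξ, Real.exp (-Ω ξ) ≤ 1 := fun ξ => by
    rw [Real.exp_le_one_iff]; linarith [hΩ0 ξ]
  have hint' : Integrable (fun ξ => |Real.log (Real.exp (-Ω ξ))| / (1 + ξ ^ 2)) := by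
    refine hint.congr (Eventually.of_forall fun ξ => ?_)
    simp only [Real.log_exp, abs_neg, abs_of_nonneg (hΩ0 ξ)]
  have hderiv : ∃ C : ℝ, ∀ ξ, |deriv (fun η => Real.log (Real.exp (-Ω η))) ξ| ≤ C := by
    refine ⟨K, fun ξ => ?_⟩
    rw [hlog]
    have hd : deriv (fun η => -Ω η) ξ = -deriv Ω ξ :=
      ((hΩ.differentiable one_ne_zero) ξ).hasDerivAt.neg.deriv
    rw [hd, abs_neg]
    exact hK ξ
  obtain ⟨ψ, hψ2, hψsupp, hψle, hψne⟩ :=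
    bourgainDyatlov2018_thm5_of_BM1 hBM1 (fun ξ => Real.exp (-Ω ξ)) hω hpos hle hint' hderiv c₀ hc₀
  have hψ1 : Integrable ψ := by
    have hb : volume (Icc (-c₀) c₀) < ⊤ := measure_Icc_lt_top
    exact memLp_one_iff_integrable.1
      (hψ2.mono_exponent_of_measure_support_ne_top hψsupp hb.ne (by norm_num))
  refine ⟨ψ, hψ1, hψ2, fun x hx => hψsupp x fun hmem => ?_, hψle, hψne⟩
  simp only [mem_Icc] at hmem
  have : |x| ≤ c₀ := abs_le.2 ⟨hmem.1, hmem.2⟩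
  linarith

end Literature.Analysis.Fourier
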